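import Mathlib.Analysis.Calculus.ContDiff.FTaylorSeries
import Mathlib.Analysis.Complex.Basic
import Mathlib.Analysis.Complex.Exponential
import Mathlib.Analysis.Normed.Group.Submodule
import Mathlib.Analysis.Normed.Module.Basic
import Mathlib.Algebra.MvPolynomial.Degrees
import Mathlib.GroupTheory.QuotientGroup.Defs
import Mathlib.LinearAlgebra.Dimension.Finrank
import Mathlib.LinearAlgebra.Prod
import Mathlib.Data.Set.Card
import HarnessLib

/-!
# The linear group `G = 𝔾ₐ^{d₀} × 𝔾ₘ^{d₁}`: points, exponential, orders of vanishing, connected subgroups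

Topic `Literature/NumberTheory/Transcendental`. Vocabulary file (definitions with bodies and their
unfolding lemmas; no named facts, nothing asserted) for the transcendence method of Gel'fond and
Schneider in several variables on the commutative LINEAR algebraic group
`G = 𝔾ₐ^{d₀} × 𝔾ₘ^{d₁}` over `ℂ` — the setting of M. Waldschmidt's Theorem 4.1 of
[Waldschmidt1988] for `G₂ = 0` (= Roy's Theorem 1, the named fact
`Literature.Barriers.Schanuel.roy1992_thm1`) and of Philippon's zero estimate
[Philippon1986, Thm 2.1] for this group. It is the verbatim generalisation, from one additive
factor to `d₀` of them, of the vocabulary of `Literature.NumberTheory.Transcendental.GaGm`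
(`PhilipponZeroEstimate.lean`, the group `𝔾ₐ × 𝔾ₘ^m`): the affine coordinates are indexed by
`Fin d₀ ⊕ Fin d₁` (`Sum.inl i` = the additive coordinate `xᵢ`, `Sum.inr j` = the multiplicative
coordinate `yⱼ`) instead of `Fin (m + 1)`.

* `LinGroup d₀ d₁` — the group of complex points `ℂ^{d₀} × (ℂˣ)^{d₁}` (multiplicative notation);
* `LinGroup.exp` — the exponential map `Lie G = ℂ^{d₀} × ℂ^{d₁} → G(ℂ)`,
  `(z₀, z₁) ↦ (z₀, (e^{z₁ⱼ})ⱼ)` (a homomorphism, `exp_add`);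
* `LinGroup.coord`, `LinGroup.evalAt` — affine coordinates and evaluation of
  `P ∈ ℂ[X₁, …, X_{d₀}, Y₁, …, Y_{d₁}] = MvPolynomial (Fin d₀ ⊕ Fin d₁) ℂ`;
* `LinGroup.degX`, `LinGroup.degY` — the total degrees in the block of additive, resp.
  multiplicative, variables ("of degree `≤ D₀` in the variables `X⁰`, `≤ D₁` in the variables `X¹`",
  [Waldschmidt1988, Prop. 6.1]);
* `LinGroup.VanishesToOrder P W g N` — `ord_g P ≥ N` along the analytic subgroup `exp_G(W)`
  ([Philippon1986, §2]; all Fréchet derivatives of order `< N` of `w ↦ P(g · exp_G w)` on `W`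
  vanish at `0`), with `vanishesToOrder_zero`, `vanishesToOrder_one_iff`, `VanishesToOrder.mono`;
* `LinGroup.sumset S n` — Philippon's `Σ(n)`;
* `LinGroup.ConnAlgSubgroup d₀ d₁` — the connected algebraic subgroups `G' = E × T'`: a vector
  subgroup `E ⊆ 𝔾ₐ^{d₀}` (any `ℂ`-subspace) times the subtorus `T'` cut out by a saturated group of
  characters `M ≤ ℤ^{d₁}`; `toSubgroup`, `torusTangent` (`Lie T'`), `tangent` (`Lie G' = E × Lie T'`),
  `addDim = dim E`, `torusDim = dim T'`, `top`, `bot`.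

## References

* [Waldschmidt1988] M. Waldschmidt, *On the transcendence methods of Gel'fond and Schneider in
  several variables*, New Advances in Transcendence Theory (A. Baker ed.), CUP 1988, 375–398:
  §4 Theorem 4.1 (pp. 382–383), §6 Proposition 6.1 (p. 389), §7 Proposition 7.1 (p. 390).
* [Philippon1986] P. Philippon, *Lemmes de zéros dans les groupes algébriques commutatifs*,
  Bull. Soc. Math. France 114 (1986), 355–383, §2 (Théorème 2.1, `ord_g P`, `Σ(n)`).
* A. Borel, *Linear Algebraic Groups*, 2nd ed., GTM 126 (1991), §8.5 (subgroups of
  `𝔾ₐ^p × 𝔾ₘ^q` in characteristic `0`).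
-/

noncomputable section

open MvPolynomial Complex

namespace Literature.NumberTheory.Transcendental

/-- The complex points `ℂ^{d₀} × (ℂˣ)^{d₁}` of the commutative linear algebraic group
`𝔾ₐ^{d₀} × 𝔾ₘ^{d₁}`, as a multiplicative commutative group. [cite: Waldschmidt1988, §4 (p. 382)] -/
abbrev LinGroup (d₀ d₁ : ℕ) : Type := Multiplicative (Fin d₀ → ℂ) × (Fin d₁ → ℂˣ)

namespace LinGroup

variable {d₀ d₁ : ℕ}

/-! ### The exponential map and affine coordinates -/

/-- The exponential map of `𝔾ₐ^{d₀} × 𝔾ₘ^{d₁}`: `(z₀, z₁) ↦ (z₀, e^{z₁₁}, …, e^{z₁d₁})` on the Lie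
algebra `ℂ^{d₀} × ℂ^{d₁}` (identified with the tangent space at the neutral element, as in
[Roy1992, §1]). [cite: Waldschmidt1988, §4 (p. 382)] -/
def exp (w : (Fin d₀ → ℂ) × (Fin d₁ → ℂ)) : LinGroup d₀ d₁ :=
  (Multiplicative.ofAdd w.1, fun j => Units.mk0 (Complex.exp (w.2 j)) (Complex.exp_ne_zero _))

/-- `exp_G(0) = e`. [folklore] -/
@[simp] theorem exp_zero : exp (0 : (Fin d₀ → ℂ) × (Fin d₁ → ℂ)) = 1 := by
  ext j <;> simp [exp]

/-- `exp_G` is a homomorphism from the (additive) Lie algebra to the group. [folklore] -/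
theorem exp_add (w w' : (Fin d₀ → ℂ) × (Fin d₁ → ℂ)) : exp (w + w') = exp w * exp w' := by
  ext j <;> simp [exp, ofAdd_add, Complex.exp_add]

/-- The second components of `exp_G(w)` are the `e^{wⱼ}`. [folklore] -/
@[simp] theorem coe_exp_snd (w : (Fin d₀ → ℂ) × (Fin d₁ → ℂ)) (j : Fin d₁) :
    ((exp w).2 j : ℂ) = Complex.exp (w.2 j) := rfl

/-- The first component of `exp_G(w)` is `w₀`. [folklore] -/
@[simp] theorem toAdd_exp_fst (w : (Fin d₀ → ℂ) × (Fin d₁ → ℂ)) :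
    Multiplicative.toAdd (exp w).1 = w.1 := rfl

/-- Affine coordinates of a point: `Sum.inl i` is the additive coordinate `xᵢ`, `Sum.inr j` the
multiplicative coordinate `yⱼ`. [folklore] -/
def coord (g : LinGroup d₀ d₁) : Fin d₀ ⊕ Fin d₁ → ℂ :=
  Sum.elim (Multiplicative.toAdd g.1) (fun j => ((g.2 j : ℂˣ) : ℂ))

/-- The additive coordinates. [folklore] -/
@[simp] theorem coord_inl (g : LinGroup d₀ d₁) (i : Fin d₀) :
    coord g (Sum.inl i) = Multiplicative.toAdd g.1 i := rfl

/-- The multiplicative coordinates. [folklore] -/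
@[simp] theorem coord_inr (g : LinGroup d₀ d₁) (j : Fin d₁) :
    coord g (Sum.inr j) = (g.2 j : ℂ) := rfl

/-- Value of `P ∈ ℂ[X₁, …, X_{d₀}, Y₁, …, Y_{d₁}]` at the point `g ∈ G(ℂ)`. [folklore] -/
def evalAt (P : MvPolynomial (Fin d₀ ⊕ Fin d₁) ℂ) (g : LinGroup d₀ d₁) : ℂ :=
  MvPolynomial.eval (coord g) P

/-- `evalAt` is a ring homomorphism in `P`. [folklore] -/
theorem evalAt_eq_eval (P : MvPolynomial (Fin d₀ ⊕ Fin d₁) ℂ) (g : LinGroup d₀ d₁) :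
    evalAt P g = MvPolynomial.eval (coord g) P := rfl

/-! ### Block degrees -/

/-- The total degree of `P` in the additive variables `X₁, …, X_{d₀}`.
[cite: Waldschmidt1988, §6 Proposition 6.1 (p. 389)] -/
def degX (P : MvPolynomial (Fin d₀ ⊕ Fin d₁) ℂ) : ℕ :=
  P.support.sup fun s => ∑ i, s (Sum.inl i)

/-- The total degree of `P` in the multiplicative variables `Y₁, …, Y_{d₁}`.
[cite: Waldschmidt1988, §6 Proposition 6.1 (p. 389)] -/
def degY (P : MvPolynomial (Fin d₀ ⊕ Fin d₁) ℂ) : ℕ :=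
  P.support.sup fun s => ∑ j, s (Sum.inr j)

/-- `degX P ≤ D ↔` every monomial of `P` has total `X`-degree `≤ D`. [folklore] -/
theorem degX_le_iff {P : MvPolynomial (Fin d₀ ⊕ Fin d₁) ℂ} {D : ℕ} :
    degX P ≤ D ↔ ∀ s ∈ P.support, ∑ i, s (Sum.inl i) ≤ D :=
  Finset.sup_le_iff

/-- `degY P ≤ D ↔` every monomial of `P` has total `Y`-degree `≤ D`. [folklore] -/
theorem degY_le_iff {P : MvPolynomial (Fin d₀ ⊕ Fin d₁) ℂ} {D : ℕ} :
    degY P ≤ D ↔ ∀ s ∈ P.support, ∑ j, s (Sum.inr j) ≤ D :=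
  Finset.sup_le_iff

/-- The zero polynomial has `degX 0 = 0`. [folklore] -/
@[simp] theorem degX_zero : degX (0 : MvPolynomial (Fin d₀ ⊕ Fin d₁) ℂ) = 0 := by
  simp [degX]

/-- The zero polynomial has `degY 0 = 0`. [folklore] -/
@[simp] theorem degY_zero : degY (0 : MvPolynomial (Fin d₀ ⊕ Fin d₁) ℂ) = 0 := by
  simp [degY]

/-! ### Orders of vanishing along an analytic subgroup, and Philippon's `Σ(n)` -/

/-- **Order of vanishing along an analytic subgroup** ([Philippon1986, §2]): for a subspace `W`
of the Lie algebra, `P` vanishes to order at least `N` at `g` along `A = exp_G(W)` iff the analytic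
function `w ↦ P(g · exp_G(w))` on `W` has all its Fréchet derivatives of order `< N` equal to `0`
at `w = 0`. [cite: Philippon1986, §2] -/
def VanishesToOrder (P : MvPolynomial (Fin d₀ ⊕ Fin d₁) ℂ)
    (W : Submodule ℂ ((Fin d₀ → ℂ) × (Fin d₁ → ℂ))) (g : LinGroup d₀ d₁) (N : ℕ) : Prop :=
  ∀ k < N, iteratedFDeriv ℂ k
    (fun w : W => evalAt P (g * exp (w : (Fin d₀ → ℂ) × (Fin d₁ → ℂ)))) 0 = 0

/-- Order `≥ 0` is no condition. [folklore] -/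
@[simp] theorem vanishesToOrder_zero (P : MvPolynomial (Fin d₀ ⊕ Fin d₁) ℂ)
    (W : Submodule ℂ ((Fin d₀ → ℂ) × (Fin d₁ → ℂ))) (g : LinGroup d₀ d₁) :
    VanishesToOrder P W g 0 :=
  fun _k hk => absurd hk (Nat.not_lt_zero _)

/-- Order `≥ 1` along any analytic subgroup just means `P(g) = 0`. [folklore] -/
theorem vanishesToOrder_one_iff (P : MvPolynomial (Fin d₀ ⊕ Fin d₁) ℂ)
    (W : Submodule ℂ ((Fin d₀ → ℂ) × (Fin d₁ → ℂ))) (g : LinGroup d₀ d₁) :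
    VanishesToOrder P W g 1 ↔ evalAt P g = 0 := by
  constructor
  · intro h
    have h0 := congrArg (‖·‖) (h 0 Nat.zero_lt_one)
    simp only [norm_iteratedFDeriv_zero, norm_zero, norm_eq_zero] at h0
    simpa using h0
  · intro h k hk
    obtain rfl : k = 0 := Nat.lt_one_iff.mp hk
    rw [← norm_eq_zero, norm_iteratedFDeriv_zero]
    simpa using h

/-- Order `≥ N` implies order `≥ N'` for `N' ≤ N`. [folklore] -/
theorem VanishesToOrder.mono {P : MvPolynomial (Fin d₀ ⊕ Fin d₁) ℂ}
    {W : Submodule ℂ ((Fin d₀ → ℂ) × (Fin d₁ → ℂ))} {g : LinGroup d₀ d₁} {N N' : ℕ}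
    (h : VanishesToOrder P W g N) (hN : N' ≤ N) : VanishesToOrder P W g N' :=
  fun k hk => h k (lt_of_lt_of_le hk hN)

/-- Philippon's `Σ(n) = {x₁ ⋯ x_n ; xᵢ ∈ Σ}` (multiplicative notation; `Σ(0) = {e}`).
[cite: Philippon1986, §2] -/
def sumset (S : Set (LinGroup d₀ d₁)) (n : ℕ) : Set (LinGroup d₀ d₁) :=
  {g | ∃ σ : Fin n → LinGroup d₀ d₁, (∀ i, σ i ∈ S) ∧ g = ∏ i, σ i}

/-- `Σ(0) = {e}`. [folklore] -/
theorem sumset_zero (S : Set (LinGroup d₀ d₁)) : sumset S 0 = {1} := by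
  ext g
  simp [sumset]

/-- If `e ∈ S` then `S ⊆ Σ(n)` for `n ≥ 1`. [folklore] -/
theorem subset_sumset {S : Set (LinGroup d₀ d₁)} (hS : (1 : LinGroup d₀ d₁) ∈ S) {n : ℕ}
    (hn : 1 ≤ n) : S ⊆ sumset S n := by
  intro g hg
  obtain ⟨k, rfl⟩ : ∃ k, n = k + 1 := ⟨n - 1, by omega⟩
  refine ⟨Fin.cons g (fun _ => 1), ?_, ?_⟩
  · refine Fin.cases ?_ (fun i => ?_) <;> simp [hg, hS]
  · simp [Fin.prod_univ_succ]

/-! ### Connected algebraic subgroups `E × T'` -/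

/-- **Connected algebraic subgroups of `𝔾ₐ^{d₀} × 𝔾ₘ^{d₁}`.** In characteristic `0` such a
subgroup is `E × T'` with `E` a vector subgroup of `𝔾ₐ^{d₀}` (an arbitrary `ℂ`-subspace,
`addPart`) and `T' = {y ; y^χ = 1 ∀ χ ∈ M}` the subtorus cut out by a subgroup `M ≤ ℤ^{d₁}` of
characters (`chars`); `T'` is connected iff `M` is saturated. (For `d₀ = 1` this is
`GaGm.ConnAlgSubgroup`, `E ∈ {0, ℂ}`.) [folklore] -/
structure ConnAlgSubgroup (d₀ d₁ : ℕ) where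
  /-- The vector part `E ⊆ ℂ^{d₀}`. -/
  addPart : Submodule ℂ (Fin d₀ → ℂ)
  /-- The characters `χ ∈ ℤ^{d₁}` of `𝔾ₘ^{d₁}` that are trivial on the torus part. -/
  chars : AddSubgroup (Fin d₁ → ℤ)
  /-- Saturation of the character lattice (= connectedness of the subtorus). -/
  saturated : ∀ (k : ℤ) (χ : Fin d₁ → ℤ), k ≠ 0 → k • χ ∈ chars → χ ∈ chars

namespace ConnAlgSubgroup

/-- The group of complex points of `G' = E × T'`. [folklore] -/
def toSubgroup (H : ConnAlgSubgroup d₀ d₁) : Subgroup (LinGroup d₀ d₁) where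
  carrier := {g | Multiplicative.toAdd g.1 ∈ H.addPart ∧
    ∀ χ ∈ H.chars, ∏ j, (g.2 j) ^ (χ j) = 1}
  one_mem' := by simp
  mul_mem' := by
    rintro ⟨a, y⟩ ⟨a', y'⟩ ⟨ha, hy⟩ ⟨ha', hy'⟩
    refine ⟨?_, fun χ hχ => ?_⟩
    · simpa [toAdd_mul] using H.addPart.add_mem ha ha'
    · have e : ∏ j, ((y * y') j) ^ (χ j) = (∏ j, (y j) ^ (χ j)) * ∏ j, (y' j) ^ (χ j) := by
        simp [mul_zpow, Finset.prod_mul_distrib]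
      have h1 : ∏ j, (y j) ^ (χ j) = 1 := hy χ hχ
      have h2 : ∏ j, (y' j) ^ (χ j) = 1 := hy' χ hχ
      show ∏ j, ((y * y') j) ^ (χ j) = 1
      rw [e, h1, h2, one_mul]
  inv_mem' := by
    rintro ⟨a, y⟩ ⟨ha, hy⟩
    refine ⟨?_, fun χ hχ => ?_⟩
    · simpa [toAdd_inv] using H.addPart.neg_mem ha
    · have e : ∏ j, ((y⁻¹) j) ^ (χ j) = (∏ j, (y j) ^ (χ j))⁻¹ := by
        simp [Finset.prod_inv_distrib]
      have h1 : ∏ j, (y j) ^ (χ j) = 1 := hy χ hχ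
      show ∏ j, ((y⁻¹) j) ^ (χ j) = 1
      rw [e, h1, inv_one]

/-- Membership in `G' = E × T'`. [folklore] -/
theorem mem_toSubgroup_iff (H : ConnAlgSubgroup d₀ d₁) (g : LinGroup d₀ d₁) :
    g ∈ H.toSubgroup ↔ Multiplicative.toAdd g.1 ∈ H.addPart ∧
      ∀ χ ∈ H.chars, ∏ j, (g.2 j) ^ (χ j) = 1 := Iff.rfl

/-- The Lie algebra of the torus part: `{v ∈ ℂ^{d₁} ; ∑ⱼ χⱼ vⱼ = 0 for all χ ∈ M}`. [folklore] -/
def torusTangent (H : ConnAlgSubgroup d₀ d₁) : Submodule ℂ (Fin d₁ → ℂ) where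
  carrier := {v | ∀ χ ∈ H.chars, ∑ j, (χ j : ℂ) * v j = 0}
  zero_mem' := by simp
  add_mem' := by
    intro v v' hv hv' χ hχ
    simp only [Pi.add_apply, mul_add, Finset.sum_add_distrib, hv χ hχ, hv' χ hχ, add_zero]
  smul_mem' := by
    intro c v hv χ hχ
    simp only [Pi.smul_apply, smul_eq_mul, mul_left_comm _ c, ← Finset.mul_sum, hv χ hχ,
      mul_zero]

/-- Membership in `Lie T'`. [folklore] -/
theorem mem_torusTangent_iff (H : ConnAlgSubgroup d₀ d₁) (v : Fin d₁ → ℂ) :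
    v ∈ H.torusTangent ↔ ∀ χ ∈ H.chars, ∑ j, (χ j : ℂ) * v j = 0 := Iff.rfl

/-- The Lie algebra `Lie G' = E × Lie T' ≤ Lie G = ℂ^{d₀} × ℂ^{d₁}` of `G' = E × T'`. [folklore] -/
def tangent (H : ConnAlgSubgroup d₀ d₁) : Submodule ℂ ((Fin d₀ → ℂ) × (Fin d₁ → ℂ)) :=
  H.addPart.prod H.torusTangent

/-- Membership in `Lie G'`. [folklore] -/
theorem mem_tangent_iff (H : ConnAlgSubgroup d₀ d₁) (w : (Fin d₀ → ℂ) × (Fin d₁ → ℂ)) :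
    w ∈ H.tangent ↔ w.1 ∈ H.addPart ∧ w.2 ∈ H.torusTangent := Submodule.mem_prod

/-- Dimension `δ₀ = dim E` of the vector part. [folklore] -/
def addDim (H : ConnAlgSubgroup d₀ d₁) : ℕ := Module.finrank ℂ H.addPart

/-- Dimension `δ₁ = dim T' = dim Lie T'` of the torus part. [folklore] -/
def torusDim (H : ConnAlgSubgroup d₀ d₁) : ℕ := Module.finrank ℂ H.torusTangent

/-- The whole group `G` (`E = ℂ^{d₀}`, `M = 0`). [folklore] -/
def top (d₀ d₁ : ℕ) : ConnAlgSubgroup d₀ d₁ where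
  addPart := ⊤
  chars := ⊥
  saturated := by
    intro k χ hk h
    rw [AddSubgroup.mem_bot] at h ⊢
    exact (smul_eq_zero.mp h).resolve_left hk

/-- The trivial subgroup `{e}` (`E = 0`, `M = ℤ^{d₁}`). [folklore] -/
def bot (d₀ d₁ : ℕ) : ConnAlgSubgroup d₀ d₁ where
  addPart := ⊥
  chars := ⊤
  saturated := fun _ _ _ _ => AddSubgroup.mem_top _

/-- Every point lies in `top`. [folklore] -/
@[simp] theorem mem_toSubgroup_top (g : LinGroup d₀ d₁) : g ∈ (top d₀ d₁).toSubgroup := by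
  simp [top, mem_toSubgroup_iff]

/-- The Lie algebra of `top` is everything. [folklore] -/
@[simp] theorem tangent_top : (top d₀ d₁).tangent = ⊤ := by
  rw [tangent, Submodule.prod_eq_top_iff]
  refine ⟨rfl, ?_⟩
  rw [eq_top_iff]
  intro v _ χ hχ
  simp only [top, AddSubgroup.mem_bot] at hχ
  simp [hχ]

/-- `bot` is the trivial subgroup. [folklore] -/
theorem mem_toSubgroup_bot_iff (g : LinGroup d₀ d₁) : g ∈ (bot d₀ d₁).toSubgroup ↔ g = 1 := by
  constructor
  · rintro ⟨h1, h2⟩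
    ext i
    · have : Multiplicative.toAdd g.1 = 0 := by simpa [bot] using h1
      simp [this]
    · have := h2 (Pi.single i 1) (AddSubgroup.mem_top _)
      rw [Finset.prod_eq_single i (fun b _ hb => by simp [Pi.single_eq_of_ne hb])
        (fun h => absurd (Finset.mem_univ i) h)] at this
      simpa using this
  · rintro rfl
    simp [bot]

/-- The Lie algebra of `bot` is zero. [folklore] -/
@[simp] theorem tangent_bot : (bot d₀ d₁).tangent = ⊥ := by
  rw [tangent, Submodule.prod_eq_bot_iff]
  refine ⟨rfl, ?_⟩
  rw [eq_bot_iff]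
  intro v hv
  rw [Submodule.mem_bot]
  funext j
  have := hv (Pi.single j 1) (AddSubgroup.mem_top _)
  rw [Finset.sum_eq_single j (fun b _ hb => by simp [Pi.single_eq_of_ne hb])
    (fun h => absurd (Finset.mem_univ j) h)] at this
  simpa using this

end ConnAlgSubgroup

end LinGroup

end Literature.NumberTheory.Transcendental
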